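import Mathlib
import Summits.ValiantsHypothesis.ValiantsHypothesis.Theorems.NewtonUnitEquationsDissociatedUniformTotalsLawUnimodal
import HarnessLib

/-!
# Crux `NewtonUnitEquations.DissociatedUniform` (stmt-ValiantsHypothesis-5905): the walk for ARBITRARY labellings — uphill flows and peak pairs

Companion of `…TotalsLawUnimodal` (the union totals law on the convexly ordered stratum via the monotone WALK towards the two
modes).  The walk needs much less than unimodality: only an UPHILL FLOW — off a designated PEAK SET every label has a neighbour
(`x ± 1`) with a value at least as large and smaller potential.  EVERY label sequence has one towards its weak local maxima
(`hasUphillFlow_localMax`, potential = number of strictly higher labels), and a cyclically unimodal one has one towards its single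
mode (`CycUnimodalAt.hasUphillFlow`).  This file records the general form, as plumbing for the MODALITY generalisation proposed in
memo `Cruxes/DissociatedUniform/NOTES-t1g5.md` §4(D):
* `HasUphillFlow f P`; `HasUphillFlow.walk` (from any pair with present fibre one reaches, without decreasing `α x + β y` and without
  leaving the present fibres, a pair over a boundary fibre or a PEAK PAIR `(x, y) ∈ P_α × P_β`);
* **`mem_fibre_or_peaks_of_isStrictTop`**: for ANY curves `a, b`, any position set `Z` and any weight `w` with uphill flows of
  `⟨w, a·⟩`, `⟨w, b·⟩` towards `P_α`, `P_β`: a strict `w`-top of `U_s(Z)` is a strict top of a boundary fibre `P_{s-z}` (`z ∈ bdry Z`) or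
  a peak pair point `a x + b y`, `x ∈ P_α`, `y ∈ P_β`;
* **`unionVert_le_card_add_of_peakPairs`**: if one finite set `S` of label pairs contains the peak pairs of suitable flows for every
  chart weight `(±1, t)`, then `#vert conv U_s(Z) ≤ #S + ∑_{z∈bdry Z} V(P_{s-z})` for every `s`, and
  `unionTotal ≤ q·#S + #bdry Z·V_P` (`unionTotal_le_of_peakPairs`).  For convexly ordered curves `S` = the hull-vertex pairs of
  `A + B` recovers `…TotalsLawUnimodal`; for labellings of bounded modality `k` the memo's count `#S ≤ k² + 4qk` is the successor's task;
* the UNCONDITIONAL instance `localMaxPairs a b` (simultaneous label-local-maximum pairs along the two charts; every sequence flows to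
  its local maxima): **`unionVert_le_card_localMaxPairs_add`**, **`unionTotal_le_of_localMaxPairs`**
  (`UT ≤ q·#localMaxPairs + #bdry Z·V_P` for EVERY labelled pair and every `Z`).
Honest label: plumbing (no new stratum closed here); the laws remain OPEN; nothing here bears on VP ≠ VNP.
[folklore]
-/

set_option linter.dupNamespace false -- `ValiantsHypothesis.ValiantsHypothesis` (summit = problem) in every name

open scoped BigOperators Pointwise

namespace Summit.ValiantsHypothesis.ValiantsHypothesis.Theorems.NewtonUnitEquationsDissociatedUniform

namespace TotalsLaw

open Literature.Computability.AlgebraicComplexity.KPTT.PlanarMinkowski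

section Flow

variable {q : ℕ} [NeZero q]

/-- An UPHILL FLOW of `f` towards the peak set `P`: some `ℕ`-valued potential strictly decreases along a neighbour step
(`x ↦ x ± 1`) that does not decrease `f`, from every label off `P`. -/
def HasUphillFlow (f : ZMod q → ℝ) (P : Finset (ZMod q)) : Prop :=
  ∃ pot : ZMod q → ℕ, ∀ x, x ∉ P → ∃ x' : ZMod q, (x' = x + 1 ∨ x' = x - 1) ∧ f x ≤ f x' ∧ pot x' < pot x

/-- A cyclically unimodal sequence flows uphill towards its mode. [folklore] -/
theorem CycUnimodalAt.hasUphillFlow {f : ZMod q → ℝ} {n : ZMod q} {d : ℕ} (h : CycUnimodalAt f n d) :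
    HasUphillFlow f {n + (d : ZMod q)} := by
  refine ⟨modeDist n d, fun x hx => h.step fun h0 => hx ?_⟩
  rw [Finset.mem_singleton]
  exact (modeDist_eq_zero_iff h.1 x).1 h0

/-- **Every label sequence flows uphill towards its weak local maxima** (labels `x` with `f (x-1) ≤ f x` and `f (x+1) ≤ f x`):
off them some neighbour is STRICTLY higher, and the number of strictly higher labels drops. [folklore] -/
theorem hasUphillFlow_localMax (f : ZMod q → ℝ) :
    HasUphillFlow f (Finset.univ.filter fun x => f (x - 1) ≤ f x ∧ f (x + 1) ≤ f x) := by
  classical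
  refine ⟨fun x => (Finset.univ.filter fun y => f x < f y).card, fun x hx => ?_⟩
  have hx' : ¬ (f (x - 1) ≤ f x ∧ f (x + 1) ≤ f x) := fun h => hx (Finset.mem_filter.2 ⟨Finset.mem_univ _, h⟩)
  -- a strictly higher neighbour
  obtain ⟨x', hx'eq, hlt⟩ : ∃ x', (x' = x + 1 ∨ x' = x - 1) ∧ f x < f x' := by
    by_cases h1 : f (x + 1) ≤ f x
    · exact ⟨x - 1, Or.inr rfl, lt_of_not_ge fun h2 => hx' ⟨h2, h1⟩⟩
    · exact ⟨x + 1, Or.inl rfl, lt_of_not_ge h1⟩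
  refine ⟨x', hx'eq, hlt.le, Finset.card_lt_card ⟨fun y hy => ?_, fun hsub => ?_⟩⟩
  · exact Finset.mem_filter.2 ⟨Finset.mem_univ _, hlt.trans (Finset.mem_filter.1 hy).2⟩
  · have := (Finset.mem_filter.1 (hsub (Finset.mem_filter.2 ⟨Finset.mem_univ _, hlt⟩))).2
    exact lt_irrefl _ this

omit [NeZero q] in
/-- **The walk, general form.**  With uphill flows of `α`, `β` towards `P_α`, `P_β` and a label set `W` whose non-boundary labels have
both neighbours in `W`: from every `(x, y)` with `x + y ∈ W` one reaches, without decreasing `α x + β y` and staying in `W`, a pair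
over a boundary label or a peak pair. [folklore] -/
theorem HasUphillFlow.walk {α β : ZMod q → ℝ} {Pα Pβ : Finset (ZMod q)} (hα : HasUphillFlow α Pα) (hβ : HasUphillFlow β Pβ)
    (W B : Finset (ZMod q)) (hWB : ∀ r ∈ W, r ∉ B → r + 1 ∈ W ∧ r - 1 ∈ W) (x y : ZMod q) (hxy : x + y ∈ W) :
    ∃ x' y' : ZMod q, x' + y' ∈ W ∧ (x' + y' ∈ B ∨ (x' ∈ Pα ∧ y' ∈ Pβ)) ∧ α x + β y ≤ α x' + β y' := by
  obtain ⟨pα, hpα⟩ := hα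
  obtain ⟨pβ, hpβ⟩ := hβ
  suffices H : ∀ N (x y : ZMod q), pα x + pβ y = N → x + y ∈ W →
      ∃ x' y' : ZMod q, x' + y' ∈ W ∧ (x' + y' ∈ B ∨ (x' ∈ Pα ∧ y' ∈ Pβ)) ∧ α x + β y ≤ α x' + β y' from H _ x y rfl hxy
  intro N
  induction N using Nat.strong_induction_on with
  | _ N ih =>
    intro x y hN hW
    by_cases hB : x + y ∈ B
    · exact ⟨x, y, hW, Or.inl hB, le_rfl⟩
    obtain ⟨hup, hdown⟩ := hWB _ hW hB
    by_cases hx0 : x ∈ Pα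
    · by_cases hy0 : y ∈ Pβ
      · exact ⟨x, y, hW, Or.inr ⟨hx0, hy0⟩, le_rfl⟩
      · obtain ⟨y', hy'eq, hfy, hlt⟩ := hpβ y hy0
        have hW' : x + y' ∈ W := by
          rcases hy'eq with rfl | rfl
          · rw [show x + (y + 1) = x + y + 1 by ring]; exact hup
          · rw [show x + (y - 1) = x + y - 1 by ring]; exact hdown
        obtain ⟨x'', y'', h1, h2, h3⟩ := ih _ (by omega) x y' rfl hW'
        exact ⟨x'', y'', h1, h2, by linarith⟩
    · obtain ⟨x', hx'eq, hfx, hlt⟩ := hpα x hx0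
      have hW' : x' + y ∈ W := by
        rcases hx'eq with rfl | rfl
        · rw [show x + 1 + y = x + y + 1 by ring]; exact hup
        · rw [show x - 1 + y = x + y - 1 by ring]; exact hdown
      obtain ⟨x'', y'', h1, h2, h3⟩ := ih _ (by omega) x' y rfl hW'
      exact ⟨x'', y'', h1, h2, by linarith⟩

variable (a b : ZMod q → (Fin 2 → ℝ))

/-- **Boundary fibre or peak pair** (any curves, any position set): with uphill flows of `⟨w, a·⟩`, `⟨w, b·⟩` towards `P_α`, `P_β`,
a strict `w`-top of `U_s(Z)` is a strict `w`-top of a boundary fibre `P_{s-z}`, `z ∈ bdry Z`, or the point `a x + b y` of a peak pair.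
[folklore] -/
theorem mem_fibre_or_peaks_of_isStrictTop {w : Fin 2 → ℝ} {Pα Pβ : Finset (ZMod q)}
    (hα : HasUphillFlow (fun x => w ⬝ᵥ a x) Pα) (hβ : HasUphillFlow (fun y => w ⬝ᵥ b y) Pβ)
    (Z : Finset (ZMod q)) (s : ZMod q) {p : Fin 2 → ℝ} (htop : IsStrictTop w (unionFin a b (Z : Set (ZMod q)) s) p) :
    (∃ z ∈ bdry Z, IsStrictTop w (fibreFin a b (s - z)) p) ∨ ∃ x ∈ Pα, ∃ y ∈ Pβ, p = a x + b y := by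
  classical
  have hpU : p ∈ unionPts a b (Z : Set (ZMod q)) s := by rw [← coe_unionFin a b (Z : Set (ZMod q)) s]; exact htop.mem
  obtain ⟨x₀, y₀, hz₀, rfl⟩ := mem_unionPts.1 hpU
  set W : Finset (ZMod q) := Finset.univ.filter fun r => s - r ∈ Z with hWdef
  set B : Finset (ZMod q) := Finset.univ.filter fun r => s - r ∈ bdry Z with hBdef
  have hWB : ∀ r ∈ W, r ∉ B → r + 1 ∈ W ∧ r - 1 ∈ W := by
    intro r hr hrB
    have hrZ : s - r ∈ Z := (Finset.mem_filter.1 hr).2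
    have hrb : s - r ∉ bdry Z := fun h => hrB (Finset.mem_filter.2 ⟨Finset.mem_univ _, h⟩)
    obtain ⟨h1, h2⟩ := neighbours_mem_of_not_mem_bdry hrZ hrb
    refine ⟨Finset.mem_filter.2 ⟨Finset.mem_univ _, ?_⟩, Finset.mem_filter.2 ⟨Finset.mem_univ _, ?_⟩⟩
    · rw [show s - (r + 1) = s - r - 1 by ring]; exact h2
    · rw [show s - (r - 1) = s - r + 1 by ring]; exact h1
  have hstart : x₀ + y₀ ∈ W :=
    Finset.mem_filter.2 ⟨Finset.mem_univ _, by rw [show s - (x₀ + y₀) = s - x₀ - y₀ by ring]; exact hz₀⟩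
  obtain ⟨x', y', hW', hcase, hle⟩ := hα.walk hβ W B hWB x₀ y₀ hstart
  have hz' : s - x' - y' ∈ Z := by
    have := (Finset.mem_filter.1 hW').2
    rwa [show s - (x' + y') = s - x' - y' by ring] at this
  have hp'U : a x' + b y' ∈ unionFin a b (Z : Set (ZMod q)) s := by
    rw [← Finset.mem_coe, coe_unionFin]
    exact mem_unionPts.2 ⟨x', y', hz', rfl⟩
  have heq : a x' + b y' = a x₀ + b y₀ := by
    by_contra hne
    have h1 := htop.lt hp'U hne
    rw [dotProduct_add, dotProduct_add] at h1
    linarith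
  rcases hcase with hB' | ⟨hxP, hyP⟩
  · left
    set z := s - (x' + y') with hzdef
    have hzb : z ∈ bdry Z := (Finset.mem_filter.1 hB').2
    refine ⟨z, hzb, ?_, fun y hy hne => htop.lt (fibreFin_subset_unionFin a b Z (bdry_subset Z hzb) hy) hne⟩
    rw [← heq]
    exact Finset.mem_image.2 ⟨x', Finset.mem_univ _, by rw [show s - z - x' = y' by rw [hzdef]; ring]⟩
  · right
    exact ⟨x', hxP, y', hyP, heq.symm⟩

/-- **Vertices of a union lie over boundary fibres or in a peak-pair set.**  If one finite set `S` of label pairs contains, for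
every chart weight `(σ, t)`, `σ = ±1`, the peak pairs `P_α × P_β` of some uphill flows of `⟨(σ,t), a·⟩`, `⟨(σ,t), b·⟩`, then
`vert conv U_s(Z) ⊆ {a x + b y : (x, y) ∈ S} ∪ ⋃_{z ∈ bdry Z} vert conv P_{s-z}`. [folklore] -/
theorem extremePoints_union_subset_of_peakPairs (S : Finset (ZMod q × ZMod q))
    (hS : ∀ σ t : ℝ, (σ = 1 ∨ σ = -1) → ∃ Pα Pβ : Finset (ZMod q),
      HasUphillFlow (fun x => ![σ, t] ⬝ᵥ a x) Pα ∧ HasUphillFlow (fun y => ![σ, t] ⬝ᵥ b y) Pβ ∧ Pα ×ˢ Pβ ⊆ S)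
    (Z : Finset (ZMod q)) (s : ZMod q) :
    (convexHull ℝ (unionPts a b (Z : Set (ZMod q)) s)).extremePoints ℝ ⊆
      ((S.image fun xy => a xy.1 + b xy.2 : Finset (Fin 2 → ℝ)) : Set (Fin 2 → ℝ)) ∪
        ⋃ z ∈ bdry Z, (convexHull ℝ (fibrePts a b (s - z))).extremePoints ℝ := by
  classical
  intro p hp
  rw [← coe_unionFin a b (Z : Set (ZMod q)) s] at hp
  rcases mem_extremePoints_iff_charts.1 hp with ⟨t, htop⟩ | ⟨t, htop⟩
  · obtain ⟨Pα, Pβ, hα, hβ, hsub⟩ := hS 1 t (Or.inl rfl)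
    rcases mem_fibre_or_peaks_of_isStrictTop a b hα hβ Z s htop with ⟨z, hz, htopz⟩ | ⟨x, hx, y, hy, rfl⟩
    · right
      rw [Set.mem_iUnion₂]
      exact ⟨z, hz, by rw [← coe_fibreFin a b (s - z)]; exact htopz.mem_extremePoints⟩
    · left
      rw [Finset.coe_image]
      exact ⟨(x, y), Finset.mem_coe.2 (hsub (Finset.mem_product.2 ⟨hx, hy⟩)), rfl⟩
  · obtain ⟨Pα, Pβ, hα, hβ, hsub⟩ := hS (-1) t (Or.inr rfl)
    rcases mem_fibre_or_peaks_of_isStrictTop a b hα hβ Z s htop with ⟨z, hz, htopz⟩ | ⟨x, hx, y, hy, rfl⟩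
    · right
      rw [Set.mem_iUnion₂]
      exact ⟨z, hz, by rw [← coe_fibreFin a b (s - z)]; exact htopz.mem_extremePoints⟩
    · left
      rw [Finset.coe_image]
      exact ⟨(x, y), Finset.mem_coe.2 (hsub (Finset.mem_product.2 ⟨hx, hy⟩)), rfl⟩

/-- **`#vert conv U_s(Z) ≤ #S + ∑_{z ∈ bdry Z} V(P_{s-z})`** under the peak-pair hypothesis — the pointwise union bound for an
arbitrary labelling in terms of its peak-pair set. [folklore] -/
theorem unionVert_le_card_add_of_peakPairs (S : Finset (ZMod q × ZMod q))
    (hS : ∀ σ t : ℝ, (σ = 1 ∨ σ = -1) → ∃ Pα Pβ : Finset (ZMod q),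
      HasUphillFlow (fun x => ![σ, t] ⬝ᵥ a x) Pα ∧ HasUphillFlow (fun y => ![σ, t] ⬝ᵥ b y) Pβ ∧ Pα ×ˢ Pβ ⊆ S)
    (Z : Finset (ZMod q)) (s : ZMod q) :
    unionVert a b (Z : Set (ZMod q)) s ≤ S.card + ∑ z ∈ bdry Z, fibreVert a b (s - z) := by
  classical
  have hfin : (((S.image fun xy => a xy.1 + b xy.2 : Finset (Fin 2 → ℝ)) : Set (Fin 2 → ℝ)) ∪
      ⋃ z ∈ bdry Z, (convexHull ℝ (fibrePts a b (s - z))).extremePoints ℝ).Finite :=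
    Set.Finite.union (Finset.finite_toSet _) (Set.Finite.biUnion (Finset.finite_toSet _) fun z _ =>
      (Set.finite_range _).subset extremePoints_convexHull_subset)
  unfold unionVert
  calc ((convexHull ℝ (unionPts a b (Z : Set (ZMod q)) s)).extremePoints ℝ).ncard
      ≤ (((S.image fun xy => a xy.1 + b xy.2 : Finset (Fin 2 → ℝ)) : Set (Fin 2 → ℝ)) ∪
          ⋃ z ∈ bdry Z, (convexHull ℝ (fibrePts a b (s - z))).extremePoints ℝ).ncard :=
        Set.ncard_le_ncard (extremePoints_union_subset_of_peakPairs a b S hS Z s) hfin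
    _ ≤ (((S.image fun xy => a xy.1 + b xy.2 : Finset (Fin 2 → ℝ)) : Set (Fin 2 → ℝ))).ncard +
          (⋃ z ∈ bdry Z, (convexHull ℝ (fibrePts a b (s - z))).extremePoints ℝ).ncard := Set.ncard_union_le _ _
    _ ≤ S.card + ∑ z ∈ bdry Z, fibreVert a b (s - z) := by
        refine add_le_add ?_ (Finset.set_ncard_biUnion_le _ _)
        rw [Set.ncard_coe_finset]
        exact Finset.card_image_le

/-- **`unionTotal ≤ q·#S + #bdry Z · V_P`** under the peak-pair hypothesis. [folklore] -/
theorem unionTotal_le_of_peakPairs (S : Finset (ZMod q × ZMod q))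
    (hS : ∀ σ t : ℝ, (σ = 1 ∨ σ = -1) → ∃ Pα Pβ : Finset (ZMod q),
      HasUphillFlow (fun x => ![σ, t] ⬝ᵥ a x) Pα ∧ HasUphillFlow (fun y => ![σ, t] ⬝ᵥ b y) Pβ ∧ Pα ×ˢ Pβ ⊆ S)
    (Z : Finset (ZMod q)) :
    unionTotal a b (Z : Set (ZMod q)) ≤ q * S.card + (bdry Z).card * fibreTotal a b := by
  unfold unionTotal
  calc ∑ s, unionVert a b (Z : Set (ZMod q)) s ≤ ∑ s, (S.card + ∑ z ∈ bdry Z, fibreVert a b (s - z)) :=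
        Finset.sum_le_sum fun s _ => unionVert_le_card_add_of_peakPairs a b S hS Z s
    _ = q * S.card + ∑ z ∈ bdry Z, ∑ s, fibreVert a b (s - z) := by
        rw [Finset.sum_add_distrib, Finset.sum_const, Finset.card_univ, ZMod.card, smul_eq_mul, Finset.sum_comm]
    _ = q * S.card + (bdry Z).card * fibreTotal a b := by
        have h : ∀ z ∈ bdry Z, ∑ s, fibreVert a b (s - z) = fibreTotal a b := fun z _ =>
          Equiv.sum_comp (Equiv.subRight z) (fibreVert a b)
        rw [Finset.sum_congr rfl h, Finset.sum_const, smul_eq_mul]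


/-! ### The unconditional form: simultaneous label-local-maximum pairs -/

/-- The LABEL-LOCAL MAXIMA of `f`: labels `x` with `f (x-1) ≤ f x` and `f (x+1) ≤ f x`. -/
noncomputable def localMax (f : ZMod q → ℝ) : Finset (ZMod q) :=
  Finset.univ.filter fun x => f (x - 1) ≤ f x ∧ f (x + 1) ≤ f x

open Classical in
/-- The SIMULTANEOUS LOCAL-MAXIMUM PAIRS of the labelled pair `(a, b)`: label pairs `(x, y)` that are label-local maxima of
`⟨w, a·⟩` and `⟨w, b·⟩` for one common chart weight `w = (±1, t)`.  (`#` of them: `≤ 2q`-ish for strictly convex curves in order,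
`O(k q)` for labellings of modality `k` — memo NOTES-t1g5 §4(D) — and `~q²` for random labellings.) -/
noncomputable def localMaxPairs : Finset (ZMod q × ZMod q) :=
  Finset.univ.filter fun xy => ∃ σ t : ℝ, (σ = 1 ∨ σ = -1) ∧
    xy.1 ∈ localMax (fun x => ![σ, t] ⬝ᵥ a x) ∧ xy.2 ∈ localMax (fun y => ![σ, t] ⬝ᵥ b y)

/-- The local-maximum pairs serve as a peak-pair set for every chart weight. [folklore] -/
theorem localMaxPairs_peakPairs : ∀ σ t : ℝ, (σ = 1 ∨ σ = -1) → ∃ Pα Pβ : Finset (ZMod q),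
    HasUphillFlow (fun x => ![σ, t] ⬝ᵥ a x) Pα ∧ HasUphillFlow (fun y => ![σ, t] ⬝ᵥ b y) Pβ ∧ Pα ×ˢ Pβ ⊆ localMaxPairs a b := by
  classical
  intro σ t hσ
  refine ⟨localMax fun x => ![σ, t] ⬝ᵥ a x, localMax fun y => ![σ, t] ⬝ᵥ b y, hasUphillFlow_localMax _, hasUphillFlow_localMax _,
    fun xy hxy => ?_⟩
  obtain ⟨hx, hy⟩ := Finset.mem_product.1 hxy
  unfold localMaxPairs
  exact Finset.mem_filter.2 ⟨Finset.mem_univ _, σ, t, hσ, hx, hy⟩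

/-- **Unconditional pointwise union bound for an ARBITRARY labelled pair**: `#vert conv U_s(Z) ≤ #localMaxPairs + ∑_{z∈bdry Z} V(P_{s-z})`.
[folklore] -/
theorem unionVert_le_card_localMaxPairs_add (Z : Finset (ZMod q)) (s : ZMod q) :
    unionVert a b (Z : Set (ZMod q)) s ≤ (localMaxPairs a b).card + ∑ z ∈ bdry Z, fibreVert a b (s - z) :=
  unionVert_le_card_add_of_peakPairs a b (localMaxPairs a b) (localMaxPairs_peakPairs a b) Z s

/-- **Unconditional union totals bound for an ARBITRARY labelled pair**: `unionTotal a b Z ≤ q·#localMaxPairs + #bdry Z·V_P` — the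
constant of the union law on few-run position sets is governed by the number of simultaneous label-local-maximum pairs of the
labelling (its "modality"). [folklore] -/
theorem unionTotal_le_of_localMaxPairs (Z : Finset (ZMod q)) :
    unionTotal a b (Z : Set (ZMod q)) ≤ q * (localMaxPairs a b).card + (bdry Z).card * fibreTotal a b :=
  unionTotal_le_of_peakPairs a b (localMaxPairs a b) (localMaxPairs_peakPairs a b) Z

end Flow

end TotalsLaw

end Summit.ValiantsHypothesis.ValiantsHypothesis.Theorems.NewtonUnitEquationsDissociatedUniform
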